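import Summits.QuantumFields.YangMills.Theorems.AllWindowsColdBoxBoxHighLineGaussianHypercontractivityPoly
import Summits.QuantumFields.YangMills.Theorems.AllWindowsColdBoxBoxHighLineEdgeChartGaussianMoments
import Summits.QuantumFields.YangMills.Theorems.AllWindowsColdBoxBoxHighLineStep2Tilt
import Summits.QuantumFields.YangMills.Theorems.SoftLoopLongLagInnerFlatSurfaceGauss

/-!
# T-S5.12e «PlaquetteObsL4» — the fourth Gaussian moment of the linearised plaquette observable: `E₀[(c_p⁽²⁾)⁴] ≤ C/β⁴`

Brick T-S5.12e of planner ym-idea-2 g18's tilt/assembly task file (✓`…Theorems.AllWindowsColdBoxBoxHighLineStep2Tilt`, copy of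
`Cruxes/BoxHighWindowsSU22/TaskS5Step2Tilt.lean`) for STEP 2 of the XL stub S5 `stub_landauSecondOrder` (LINE-19, ⟨stmt-QuantumFields-24004⟩/⟨24335⟩) —
the `L⁴` bound that is LOAD-BEARING in the even part of `f′(0)` (ASSEMBLY-S5 (e4)).  BY NAME:

  `plaquetteObsL4 : PlaquetteObsL4`  —  `∃ C, ∀ H ≥ 1, ∀ β ≥ 1, ∀ x, gaussAvg β H (fun a => linCurvSq H (plaq12At x) a ^ 4) ≤ C / β ^ 4`,  `C = 81·(15/4)²`.

Route («w5's hypercontractivity», as the task file says):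
* `gaussAvg_linCurvSq` / `gaussAvg_linCurvSq_sq` — the EXACT Gaussian sizes `E₀[c_p⁽²⁾] = (3/2)·β⁻¹·K_p` and `E₀[(c_p⁽²⁾)²] = (15/4)·β⁻²·K_p²`,
  `K_p = landauCoeff H p ⬝ (hodgeQ H)⁻¹ landauCoeff H p` (LEAD's ✓`EdgeChartGaussian.integral_colourSumSq_mul_exp` + ✓`cov_colourSumSq`, unfolded letters);
* `gaussAvg_linCurvSq_pow_four_le` — `E₀[(c_p⁽²⁾)⁴] ≤ 81 · E₀[(c_p⁽²⁾)²]²`: `c_p⁽²⁾ = Σ_c (colour leg ⬝ ♭a)²` is a polynomial of degree `≤ 2` of the flat chart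
  variable (✓`integral_legs_eq_flat` + ✓`Hypercontractivity.polyDeg_*`), so the `(2,4)` Bonami–Nelson bound
  ✓`Hypercontractivity.integral_pow_four_mul_integral_exp_le_of_polyDeg` applies (`9² = 81`);
* `hodgeKernel_plaq12At_sq_le_one` — `K_p = boxDirProjKernel H p p` (✓S2 `stub_kernelHodgeForm`) and `|boxDirProjKernel H p p| ≤ 1` for the
  `(1,2)`-plaquettes (✓`SoftLoopLongLag.abs_boxDirProjKernel_le_one`), hence `gaussAvg_linCurvSq_sq_le` = 12d's first clause `E₀[(c_p⁽²⁾)²] ≤ (15/4)/β²`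
  (exported for the 12d holder) and the headline bound.

Tree + Mathlib only; no definitions.  HONEST LABEL: one S brick of STEP 2 of the XL stub S5 of a critic-PASSed DRAFT line; 12d, S5, U5,
⟨stmt-QuantumFields-24004⟩ ⟨24335⟩ ⟨24336⟩ remain OPEN; route AllWindowsColdBox is DRAFT; no rung is proved; **the Yang–Mills mass gap is NOT proved
by this file; no summit is proved by a line.**  Seat ym-line-sfw-p2-w5 g22 (EXTRA WIDTH seat w5, cell ym-idea-1).
-/

set_option autoImplicit false

noncomputable section

open MeasureTheory Matrix Finset
open scoped Kronecker
open Literature.Probability.LatticeModels (Site)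
open Literature.MathematicalPhysics.QuantumFieldTheory (Plaq)
open Summit.QuantumFields.YangMills.Theorems.WeakCouplingRates (plaq12At boxDirProjKernel)

namespace Summit.QuantumFields.YangMills.Theorems.AllWindowsColdBoxBoxHighLine

namespace PlaqObsL4

open Hypercontractivity

variable (H : ℕ)

/-- The task's Gaussian weight in LEAD's unfolded letters. -/
theorem gaussWeight_eq (β : ℝ) (a : LandauFree H → E3) :
    gaussWeight β H a = Real.exp (-(β * ∑ c : Fin 3, (fun e => a e c) ⬝ᵥ (hodgeQ H *ᵥ fun e => a e c))) := rfl

/-- The linearised plaquette observable in LEAD's unfolded letters: `c_p⁽²⁾(a) = Σ_c (landauCoeff H p ⬝ a^c)²`. -/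
theorem linCurvSq_eq (p : Plaq 4) (a : LandauFree H → E3) :
    linCurvSq H p a = ∑ c : Fin 3, (landauCoeff H p ⬝ᵥ fun e => a e c) ^ 2 := rfl

/-- The normaliser is positive. -/
theorem integral_gaussWeight_pos {β : ℝ} (hβ : 0 < β) : 0 < ∫ a : LandauFree H → E3, gaussWeight β H a :=
  EdgeChartGaussian.integral_exp_neg_colourForm_pos (hodgeQ H) (hodgeQ_posDef H) hβ

/-- **`E₀[c_p⁽²⁾] = (3/2)·β⁻¹·K_p`**, `K_p = landauCoeff H p ⬝ (hodgeQ H)⁻¹ landauCoeff H p`. -/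
theorem gaussAvg_linCurvSq {β : ℝ} (hβ : 0 < β) (p : Plaq 4) :
    gaussAvg β H (linCurvSq H p) = 3 / 2 * β⁻¹ * (landauCoeff H p ⬝ᵥ ((hodgeQ H)⁻¹ *ᵥ landauCoeff H p)) := by
  have hZ := integral_gaussWeight_pos H hβ
  unfold gaussAvg
  simp only [linCurvSq_eq, gaussWeight_eq]
  rw [EdgeChartGaussian.integral_colourSumSq_mul_exp (hodgeQ H) (hodgeQ_posDef H) hβ,
    EdgeChartGaussian.integral_exp_neg_colourForm (hodgeQ H) (hodgeQ_posDef H) hβ]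
  have hZ' : 0 < Real.sqrt (Real.pi / β) ^ Fintype.card (LandauFree H × Fin 3) /
      Real.sqrt (hodgeQ H ⊗ₖ (1 : Matrix (Fin 3) (Fin 3) ℝ)).det := by
    rw [← EdgeChartGaussian.integral_exp_neg_colourForm (hodgeQ H) (hodgeQ_posDef H) hβ]; exact hZ
  rw [mul_div_cancel_left₀ _ hZ'.ne']
  field_simp

/-- **`E₀[(c_p⁽²⁾)²] = (15/4)·β⁻²·K_p²`** (Wick: `E₀[c²] = E₀[c]² + 2·(3/2)·…`, LEAD's ✓`cov_colourSumSq` at `u = w`). -/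
theorem gaussAvg_linCurvSq_sq {β : ℝ} (hβ : 0 < β) (p : Plaq 4) :
    gaussAvg β H (fun a => linCurvSq H p a ^ 2) =
      15 / 4 * (β⁻¹) ^ 2 * (landauCoeff H p ⬝ᵥ ((hodgeQ H)⁻¹ *ᵥ landauCoeff H p)) ^ 2 := by
  have hcov := EdgeChartGaussian.cov_colourSumSq (hodgeQ H) (hodgeQ_posDef H) hβ (landauCoeff H p) (landauCoeff H p)
  have hmean := gaussAvg_linCurvSq H hβ p
  unfold gaussAvg at hmean ⊢
  simp only [linCurvSq_eq, gaussWeight_eq] at hmean ⊢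
  rw [hmean] at hcov
  have hsq : ∀ a : LandauFree H → E3, (∑ c : Fin 3, (landauCoeff H p ⬝ᵥ fun e => a e c) ^ 2) ^ 2 =
      (∑ c : Fin 3, (landauCoeff H p ⬝ᵥ fun e => a e c) ^ 2) * (∑ c : Fin 3, (landauCoeff H p ⬝ᵥ fun e => a e c) ^ 2) :=
    fun a => pow_two _
  simp only [hsq]
  linear_combination hcov

/-- **Hypercontractivity step**: `E₀[(c_p⁽²⁾)⁴] ≤ 81 · E₀[(c_p⁽²⁾)²]²` — `c_p⁽²⁾` is polynomial of degree `≤ 2` in the flat chart variable. -/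
theorem gaussAvg_linCurvSq_pow_four_le {β : ℝ} (hβ : 0 < β) (p : Plaq 4) :
    gaussAvg β H (fun a => linCurvSq H p a ^ 4) ≤ 81 * gaussAvg β H (fun a => linCurvSq H p a ^ 2) ^ 2 := by
  have hZ := integral_gaussWeight_pos H hβ
  set L := hodgeQ H with hL
  set u := landauCoeff H p with hu
  set P : Matrix (LandauFree H × Fin 3) (LandauFree H × Fin 3) ℝ := L ⊗ₖ (1 : Matrix (Fin 3) (Fin 3) ℝ) with hP
  have hPd : P.PosDef := GaussianChartWick.posDef_kronecker_one L (hodgeQ_posDef H)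
  -- transfer of the three integrals
  have h4 := EdgeChartGaussian.integral_legs_eq_flat L β (fun x _ => (∑ c : Fin 3, x c ^ 2) ^ 4) u u
  have h2 := EdgeChartGaussian.integral_legs_eq_flat L β (fun x _ => (∑ c : Fin 3, x c ^ 2) ^ 2) u u
  have h0 := EdgeChartGaussian.integral_legs_eq_flat L β (fun _ _ => (1 : ℝ)) u u
  beta_reduce at h4 h2
  simp only [one_mul] at h0
  -- `G v = Σ_c (ℓ_c ⬝ v)²` is polynomial of degree ≤ 2 in the flat variable
  have hG : ∃ Q : MvPolynomial (LandauFree H × Fin 3) ℝ, Q.totalDegree ≤ 2 ∧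
      ∀ v : LandauFree H × Fin 3 → ℝ,
        (∑ c : Fin 3, ((fun q : LandauFree H × Fin 3 => if q.2 = c then u q.1 else 0) ⬝ᵥ v) ^ 2) = MvPolynomial.eval v Q := by
    refine polyDeg_sum Finset.univ
      (F := fun c v => ((fun q : LandauFree H × Fin 3 => if q.2 = c then u q.1 else 0) ⬝ᵥ v) ^ 2) fun c _ => ?_
    exact polyDeg_mono (by norm_num) (polyDeg_pow (polyDeg_dotProduct _ le_rfl) 2)
  have hH := integral_pow_four_mul_integral_exp_le_of_polyDeg P hPd hβ hG
  -- back to the `a`-letters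
  unfold gaussAvg
  simp only [linCurvSq_eq, gaussWeight_eq]
  rw [h4, h2, h0]
  set A := ∫ v : LandauFree H × Fin 3 → ℝ,
    (∑ c : Fin 3, ((fun q : LandauFree H × Fin 3 => if q.2 = c then u q.1 else 0) ⬝ᵥ v) ^ 2) ^ 4 *
      Real.exp (-(β * (v ⬝ᵥ (P *ᵥ v)))) with hA
  set B := ∫ v : LandauFree H × Fin 3 → ℝ,
    (∑ c : Fin 3, ((fun q : LandauFree H × Fin 3 => if q.2 = c then u q.1 else 0) ⬝ᵥ v) ^ 2) ^ 2 *
      Real.exp (-(β * (v ⬝ᵥ (P *ᵥ v)))) with hB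
  set Z := ∫ v : LandauFree H × Fin 3 → ℝ, Real.exp (-(β * (v ⬝ᵥ (P *ᵥ v)))) with hZdef
  have hZ0 : 0 < Z := by rw [← h0]; exact hZ
  have key : A * Z ≤ 81 * B ^ 2 := by
    have h := hH
    norm_num at h
    exact h
  calc A / Z = A * Z / Z ^ 2 := by field_simp
    _ ≤ 81 * B ^ 2 / Z ^ 2 := div_le_div_of_nonneg_right key (sq_nonneg _)
    _ = 81 * (B / Z) ^ 2 := by rw [div_pow]; ring

/-- **`K_p = boxDirProjKernel H p p`** (✓S2) and `|boxDirProjKernel| ≤ 1` on `(1,2)`-plaquettes: `K_{plaq12At x}² ≤ 1`. -/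
theorem hodgeKernel_plaq12At_sq_le_one (hH : 1 ≤ H) (x : Site 4) :
    (landauCoeff H (plaq12At x) ⬝ᵥ ((hodgeQ H)⁻¹ *ᵥ landauCoeff H (plaq12At x))) ^ 2 ≤ 1 := by
  rw [← stub_kernelHodgeForm H hH]
  have h := Summit.QuantumFields.YangMills.Theorems.SoftLoopLongLag.abs_boxDirProjKernel_le_one (H := H)
    ⟨x, ⟨((1 : Fin 4), (2 : Fin 4)), by decide⟩⟩ ⟨x, ⟨((1 : Fin 4), (2 : Fin 4)), by decide⟩⟩
  have h' : |boxDirProjKernel H (plaq12At x) (plaq12At x)| ≤ 1 := h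
  have := abs_le.mp h'
  nlinarith [this.1, this.2]

/-- **12d, first clause** (exported for the 12d holder): `E₀[(c_p⁽²⁾)²] ≤ (15/4)/β²` for `p = plaq12At x`, `H ≥ 1`, `β > 0`. -/
theorem gaussAvg_linCurvSq_sq_le (hH : 1 ≤ H) {β : ℝ} (hβ : 0 < β) (x : Site 4) :
    gaussAvg β H (fun a => linCurvSq H (plaq12At x) a ^ 2) ≤ 15 / 4 / β ^ 2 := by
  rw [gaussAvg_linCurvSq_sq H hβ]
  have hK := hodgeKernel_plaq12At_sq_le_one H hH x
  have hβ2 : 0 < (β⁻¹) ^ 2 := by positivity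
  calc 15 / 4 * (β⁻¹) ^ 2 * (landauCoeff H (plaq12At x) ⬝ᵥ ((hodgeQ H)⁻¹ *ᵥ landauCoeff H (plaq12At x))) ^ 2
      ≤ 15 / 4 * (β⁻¹) ^ 2 * 1 := mul_le_mul_of_nonneg_left hK (by positivity)
    _ = 15 / 4 / β ^ 2 := by field_simp

end PlaqObsL4

open PlaqObsL4 in
/-- **T-S5.12e `PlaquetteObsL4`** — `E₀[(c_p⁽²⁾)⁴] ≤ C/β⁴` with `C = 81·(15/4)²` for every `H ≥ 1`, `β ≥ 1` and every base point `x`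
(hypercontractivity `E₀[c⁴] ≤ 81·E₀[c²]²` and the exact `E₀[c²] = (15/4)β⁻²K²`, `K² ≤ 1`). -/
theorem plaquetteObsL4 : PlaquetteObsL4 := by
  refine ⟨81 * (15 / 4) ^ 2, fun H hH β hβ x => ?_⟩
  have hβ0 : 0 < β := lt_of_lt_of_le one_pos hβ
  have h4 := gaussAvg_linCurvSq_pow_four_le H hβ0 (plaq12At x)
  have h2 := gaussAvg_linCurvSq_sq_le H hH hβ0 x
  have h2' : 0 ≤ gaussAvg β H (fun a => linCurvSq H (plaq12At x) a ^ 2) := by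
    rw [gaussAvg_linCurvSq_sq H hβ0]; positivity
  calc gaussAvg β H (fun a => linCurvSq H (plaq12At x) a ^ 4)
      ≤ 81 * gaussAvg β H (fun a => linCurvSq H (plaq12At x) a ^ 2) ^ 2 := h4
    _ ≤ 81 * (15 / 4 / β ^ 2) ^ 2 := by
        refine mul_le_mul_of_nonneg_left ?_ (by norm_num)
        exact pow_le_pow_left₀ h2' h2 2
    _ = 81 * (15 / 4) ^ 2 / β ^ 4 := by field_simp

end Summit.QuantumFields.YangMills.Theorems.AllWindowsColdBoxBoxHighLine

end
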